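import Summits.Ventures.PercRepro.HyperplaneKey

/-!
# PercRepro — `e`-FREENESS IS «TWO COCIRCUITS THROUGH EVERY POINT MEETING EXACTLY THERE» (p1, gen 42; a reformulation)

`e ∉ cl A` (for `A ⊆ E ∖ {e}`) holds exactly when some cocircuit through `e` misses `A`
(`notMem_closure_iff_exists_isCocircuit`: ⟹ extend a basis of `A` together with `e` to a base `B` and take
`E ∖ cl(B ∖ {e})`; ⟸ the complement of a cocircuit is non-spanning while adding `e` makes it spanning). Hence the cell's
`hfree` hypothesis — every point splits the rest into two parts neither of which spans it — is equivalent to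
**every point lying in two cocircuits whose intersection is exactly that point** (`free_iff_forall_exists_two_isCocircuit`).
Nothing about any cell is claimed here.

* `notMem_closure_iff_exists_isCocircuit`;
* `free_iff_forall_exists_two_isCocircuit`.
Axioms: standard.
-/

open scoped Matroid

namespace PercRepro

namespace HypKey

open Set

variable {α : Type}

/-- **`e ∉ cl A ⟺ a cocircuit through `e` misses `A`** (`A ⊆ E`, `e ∈ E ∖ A`). -/
theorem notMem_closure_iff_exists_isCocircuit (M : Matroid α) [M.Finite] {A : Set α} {e : α}
    (hA : A ⊆ M.E) (he : e ∈ M.E) (heA : e ∉ A) :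
    e ∉ M.closure A ↔ ∃ K, M.IsCocircuit K ∧ e ∈ K ∧ Disjoint K A := by
  constructor
  · intro hcl
    obtain ⟨I, hI⟩ := M.exists_isBasis A hA
    have heI : e ∉ I := fun h => heA (hI.subset h)
    have hIe : M.Indep (insert e I) := by
      rw [hI.indep.insert_indep_iff_of_notMem heI]
      refine ⟨he, fun h => hcl ?_⟩
      rw [← hI.closure_eq_closure]
      exact h
    obtain ⟨B, hB, hIB⟩ := hIe.exists_isBase_superset
    have heB : e ∈ B := hIB (mem_insert e I)
    refine ⟨M.E \ M.closure (B \ {e}), hB.compl_closure_sdiff_singleton_isCocircuit heB, ?_, ?_⟩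
    · exact ⟨he, hB.indep.notMem_closure_sdiff_of_mem heB⟩
    · rw [Set.disjoint_left]
      rintro x ⟨-, hx⟩ hxA
      apply hx
      have hIB' : I ⊆ B \ {e} := fun y hy => ⟨hIB (mem_insert_of_mem e hy), fun hye => heI (hye ▸ hy)⟩
      have : A ⊆ M.closure (B \ {e}) := by
        calc A ⊆ M.closure A := M.subset_closure A hA
          _ = M.closure I := hI.closure_eq_closure.symm
          _ ⊆ M.closure (B \ {e}) := M.closure_subset_closure hIB'
      exact this hxA
  · rintro ⟨K, hK, heK, hKA⟩ hcl
    rw [Matroid.isCocircuit_iff_minimal_compl_nonspanning] at hK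
    obtain ⟨hns, hmin⟩ := hK
    have hKE : K ⊆ M.E := by
      intro x hx
      by_contra hxE
      -- `K ∖ {x}` has the same complement in `E`, contradicting minimality
      have h1 : ¬ M.Spanning (M.E \ (K \ {x})) := by
        rwa [show M.E \ (K \ {x}) = M.E \ K by
          ext y; simp only [mem_sdiff, mem_singleton_iff]; constructor
          · rintro ⟨hy, hyK⟩; exact ⟨hy, fun h => hyK ⟨h, fun hyx => hxE (hyx ▸ hy)⟩⟩
          · rintro ⟨hy, hyK⟩; exact ⟨hy, fun h => hyK h.1⟩]
      have := hmin h1 sdiff_subset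
      exact (this hx).2 rfl
    have hAK : A ⊆ M.E \ K := fun x hx => ⟨hA hx, fun hxK => hKA.notMem_of_mem_left hxK hx⟩
    -- `E ∖ (K ∖ {e}) = (E ∖ K) ∪ {e}` is spanning by minimality
    have hsp : M.Spanning (M.E \ (K \ {e})) := by
      by_contra h
      have := hmin h sdiff_subset
      exact (this heK).2 rfl
    have hEq : M.E \ (K \ {e}) = insert e (M.E \ K) := by
      ext y; simp only [mem_sdiff, mem_singleton_iff, mem_insert_iff]
      constructor
      · rintro ⟨hy, hyK⟩
        by_cases hye : y = e
        · exact Or.inl hye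
        · exact Or.inr ⟨hy, fun h => hyK ⟨h, hye⟩⟩
      · rintro (rfl | ⟨hy, hyK⟩)
        · exact ⟨he, fun h => h.2 rfl⟩
        · exact ⟨hy, fun h => hyK h.1⟩
    rw [hEq] at hsp
    have hecl : e ∈ M.closure (M.E \ K) := M.closure_subset_closure hAK hcl
    have hsp' : M.Spanning (M.E \ K) := by
      rw [Matroid.spanning_iff_closure_eq sdiff_subset]
      rw [Matroid.spanning_iff_closure_eq (insert_subset he sdiff_subset),
        Matroid.closure_insert_eq_of_mem_closure hecl] at hsp
      exact hsp
    exact hns hsp'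

/-- **`e`-freeness ⟺ every point lies in two cocircuits meeting exactly in it.** -/
theorem free_iff_forall_exists_two_isCocircuit (M : Matroid α) [M.Finite] :
    (∀ e ∈ M.E, ∃ A ⊆ M.E \ {e}, e ∉ M.closure A ∧ e ∉ M.closure ((M.E \ {e}) \ A)) ↔
      ∀ e ∈ M.E, ∃ K₁ K₂, M.IsCocircuit K₁ ∧ M.IsCocircuit K₂ ∧ K₁ ∩ K₂ = {e} := by
  constructor
  · intro hfree e he
    obtain ⟨A, hA, heA, heB⟩ := hfree e he
    have hAE : A ⊆ M.E := hA.trans sdiff_subset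
    have heA' : e ∉ A := fun h => (hA h).2 rfl
    have hBE : (M.E \ {e}) \ A ⊆ M.E := sdiff_subset.trans sdiff_subset
    have heB' : e ∉ (M.E \ {e}) \ A := fun h => h.1.2 rfl
    obtain ⟨K₁, hK₁, heK₁, hK₁A⟩ := (notMem_closure_iff_exists_isCocircuit M hAE he heA').1 heA
    obtain ⟨K₂, hK₂, heK₂, hK₂B⟩ := (notMem_closure_iff_exists_isCocircuit M hBE he heB').1 heB
    refine ⟨K₁, K₂, hK₁, hK₂, ?_⟩
    ext x
    simp only [mem_inter_iff, mem_singleton_iff]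
    constructor
    · rintro ⟨hx₁, hx₂⟩
      by_contra hxe
      have hxE : x ∈ M.E := hK₁.subset_ground hx₁
      have hxA : x ∉ A := fun h => hK₁A.notMem_of_mem_left hx₁ h
      have hxB : x ∈ (M.E \ {e}) \ A := ⟨⟨hxE, hxe⟩, hxA⟩
      exact hK₂B.notMem_of_mem_left hx₂ hxB
    · rintro rfl
      exact ⟨heK₁, heK₂⟩
  · intro h e he
    obtain ⟨K₁, K₂, hK₁, hK₂, hK⟩ := h e he
    have heK₁ : e ∈ K₁ := (hK ▸ (mem_singleton e) : e ∈ K₁ ∩ K₂).1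
    have heK₂ : e ∈ K₂ := (hK ▸ (mem_singleton e) : e ∈ K₁ ∩ K₂).2
    refine ⟨(M.E \ {e}) \ K₁, sdiff_subset, ?_, ?_⟩
    · have hAE : (M.E \ {e}) \ K₁ ⊆ M.E := sdiff_subset.trans sdiff_subset
      have heA : e ∉ (M.E \ {e}) \ K₁ := fun h => h.1.2 rfl
      rw [notMem_closure_iff_exists_isCocircuit M hAE he heA]
      exact ⟨K₁, hK₁, heK₁, Set.disjoint_left.2 (fun x hx hx' => hx'.2 hx)⟩
    · have hBE : (M.E \ {e}) \ ((M.E \ {e}) \ K₁) ⊆ M.E := sdiff_subset.trans sdiff_subset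
      have heB : e ∉ (M.E \ {e}) \ ((M.E \ {e}) \ K₁) := fun h => h.1.2 rfl
      rw [notMem_closure_iff_exists_isCocircuit M hBE he heB]
      refine ⟨K₂, hK₂, heK₂, Set.disjoint_left.2 (fun x hx hx' => ?_)⟩
      -- `x ∈ K₂`, `x ∈ E ∖ {e}`, `x ∉ (E ∖ {e}) ∖ K₁` ⇒ `x ∈ K₁` ⇒ `x ∈ K₁ ∩ K₂ = {e}`, contradiction
      have hx₁ : x ∈ K₁ := by
        by_contra hx₁
        exact hx'.2 ⟨hx'.1, hx₁⟩
      have : x ∈ K₁ ∩ K₂ := ⟨hx₁, hx⟩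
      rw [hK] at this
      exact hx'.1.2 this

end HypKey

end PercRepro
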